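import Summits.RiemannHypothesis.RiemannHypothesis.Theorems.PfPersistenceProfileDerivLag
import HarnessLib

/-!
# The dilation profile at an entering window: regular part and entering term — RH-free helper

pub-rhpf (mechanism / rigidity campaign; **no RH claims**), theory-1 gen 5, THEORY-EDGE-5 §2.4.

At a window radius `a` the prime-lag part of the dilation profile of a ground state
(`weilPrimeLagPart a u η = Σ_{2 ≤ n, log n ≤ 2a} Λ(n) n^{-1/2} D_{log n}(ũ_η)`, `ũ = weilTrunc a u`)
splits into the INTERIOR part (lags `log n < 2a`, `weilInteriorLagPart`) and the ENTERING term
`w_ent(a) · D_{2a}(ũ_η)` with the **entering weight**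
`w_ent(a) = weilEnteringWeight a = Σ_{2 ≤ n, log n = 2a} Λ(n) n^{-1/2}` (`= Λ(n₀) n₀^{-1/2}` when
`e^{2a} = n₀` is a prime power, `0` otherwise) — `weilPrimeLagPart_eq_interior_add_entering`.

`hasDerivAt_weilDilationProfile_sub_entering` (PROVED, sorry-free): for a ground state `u` of the
window `a`, the REGULAR PART `η ↦ (profile)(η) − w_ent(a) · D_{2a}(ũ_η)` is differentiable at
`η = 0` with derivative `V_sw(u) + Σ_{log n < 2a} Λ(n) n^{-1/2} · log n · d n` as soon as the
increment `t ↦ D_t(ũ)` is differentiable (derivative `d n`) at the INTERIOR prime-power lags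
`log n ∈ (0, 2a)` — the hypothesis `hR` of the schema-level corner
(`Theorems/PfPersistenceEdgeLawCorner`, `WindowForm.corner_of_entering_lag`) for `ζ`, with
`c = w_ent(a)`.  The entering term itself is NOT differentiable at `η = 0` when the state has
non-zero edge values (`Theorems/PfPersistenceEdgeLawEdgeValue`): that is the kink.

No arithmetic input beyond the explicit formula; no RH content.

References: E. Bombieri, Rend. Mat. Acc. Lincei (9) 11 (2000) 183–233, §4; T. Kato, *Perturbation
Theory for Linear Operators* (1966) VII §4.6, §6.5.
-/

set_option linter.dupNamespace false

noncomputable section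

open MeasureTheory Set Filter
open scoped Topology

namespace Summit.RiemannHypothesis.RiemannHypothesis.Theorems.PfPersistence

open Literature.NumberTheory.LFunctions
open Summit.RiemannHypothesis.RiemannHypothesis.Theorems.WeilWindowFlowWindowLipschitz

/-! ## §1 Interior lags, entering weight -/

/-- The prime powers `2 ≤ n` with `log n ≤ 2a` (the index set of `weilPrimeLagPart a`). -/
def weilLagIndex (a : ℝ) : Finset ℕ :=
  (weilPrimeIndex (2 * a)).filter (fun n : ℕ ↦ 2 ≤ n ∧ Real.log (n : ℝ) ≤ 2 * a)

/-- The INTERIOR prime-power lags of the window `a`: `2 ≤ n`, `log n < 2a`. -/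
def weilInteriorLagIndex (a : ℝ) : Finset ℕ :=
  (weilLagIndex a).filter (fun n : ℕ ↦ Real.log (n : ℝ) < 2 * a)

/-- The **entering weight** of the window `a`: `Σ_{2 ≤ n, log n = 2a} Λ(n) n^{-1/2}` — the weight
of the prime power (if any) whose lag is exactly the support diameter `2a`. -/
def weilEnteringWeight (a : ℝ) : ℝ :=
  ∑ n ∈ (weilLagIndex a).filter (fun n : ℕ ↦ ¬ Real.log (n : ℝ) < 2 * a),
    (ArithmeticFunction.vonMangoldt n : ℝ) / Real.sqrt n

/-- The **interior prime-lag part** of the dilation profile: the lags `log n < 2a`. -/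
def weilInteriorLagPart (a : ℝ) (u : ℝ → ℂ) (η : ℝ) : ℝ :=
  ∑ n ∈ weilInteriorLagIndex a,
    (ArithmeticFunction.vonMangoldt n : ℝ) / Real.sqrt n *
      weilIncrement (weilDilate η (weilTrunc a u)) (Real.log n)

/-- The entering weight is non-negative (`Λ ≥ 0`). -/
theorem weilEnteringWeight_nonneg (a : ℝ) : 0 ≤ weilEnteringWeight a :=
  Finset.sum_nonneg fun _ _ ↦
    div_nonneg ArithmeticFunction.vonMangoldt_nonneg (Real.sqrt_nonneg _)

/-- The entering weight vanishes unless `e^{2a}` is an integer `≥ 2`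
(i.e. if `log n ≠ 2a` for every `2 ≤ n`). -/
theorem weilEnteringWeight_eq_zero {a : ℝ} (h : ∀ n : ℕ, 2 ≤ n → Real.log (n : ℝ) ≠ 2 * a) :
    weilEnteringWeight a = 0 := by
  refine Finset.sum_eq_zero fun n hn ↦ ?_
  simp only [weilLagIndex, Finset.mem_filter, not_lt] at hn
  exact absurd (le_antisymm hn.1.2.2 hn.2) (h n hn.1.2.1)

/-- **Splitting off the entering term**:
`weilPrimeLagPart a u η = weilInteriorLagPart a u η + w_ent(a) · D_{2a}(ũ_η)`. -/
theorem weilPrimeLagPart_eq_interior_add_entering (a : ℝ) (u : ℝ → ℂ) (η : ℝ) :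
    weilPrimeLagPart a u η = weilInteriorLagPart a u η +
      weilEnteringWeight a * weilIncrement (weilDilate η (weilTrunc a u)) (2 * a) := by
  unfold weilPrimeLagPart weilInteriorLagPart weilEnteringWeight weilInteriorLagIndex
  rw [← show weilLagIndex a = (weilPrimeIndex (2 * a)).filter
      (fun n : ℕ ↦ 2 ≤ n ∧ Real.log (n : ℝ) ≤ 2 * a) from rfl,
    ← Finset.sum_filter_add_sum_filter_not (weilLagIndex a) (fun n : ℕ ↦ Real.log (n : ℝ) < 2 * a),
    Finset.sum_mul]
  congr 1
  refine Finset.sum_congr rfl fun n hn ↦ ?_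
  simp only [weilLagIndex, Finset.mem_filter, not_lt] at hn
  rw [le_antisymm hn.1.2.2 hn.2]

/-! ## §2 The interior part is differentiable under interior regularity -/

/-- Chain rule on `D_{log n}(ũ_η) = D_{(1+η) log n}(ũ)` over the interior lags. [folklore] -/
theorem hasDerivAt_weilInteriorLagPart {a : ℝ} {u : ℝ → ℂ} {d : ℕ → ℝ}
    (hd : ∀ n ∈ weilInteriorLagIndex a,
      HasDerivAt (weilIncrement (weilTrunc a u)) (d n) (Real.log n)) :
    HasDerivAt (weilInteriorLagPart a u)
      (∑ n ∈ weilInteriorLagIndex a,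
        (ArithmeticFunction.vonMangoldt n : ℝ) / Real.sqrt n * (Real.log n * d n)) 0 := by
  unfold weilInteriorLagPart
  refine HasDerivAt.fun_sum fun n hn ↦ ?_
  refine HasDerivAt.const_mul _ ?_
  have hlin : HasDerivAt (fun η : ℝ ↦ (1 + η) * Real.log n) (Real.log n) 0 := by
    simpa using ((hasDerivAt_id (0 : ℝ)).const_add 1).mul_const (Real.log n)
  have hd' : HasDerivAt (weilIncrement (weilTrunc a u)) (d n) ((1 + (0 : ℝ)) * Real.log n) := by
    rw [add_zero, one_mul]
    exact hd n hn
  have hcomp : HasDerivAt (weilIncrement (weilTrunc a u) ∘ fun η : ℝ ↦ (1 + η) * Real.log n)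
      (d n * Real.log n) 0 := hd'.comp 0 hlin
  refine (hcomp.congr_of_eventuallyEq ?_).congr_deriv (by ring)
  filter_upwards [Ioi_mem_nhds (show (-1 : ℝ) < 0 by norm_num)] with η hη
  show weilIncrement (weilDilate η (weilTrunc a u)) (Real.log n) =
    weilIncrement (weilTrunc a u) ((1 + η) * Real.log n)
  exact weilIncrement_weilDilate _ hη _

/-! ## §3 The regular part of the profile at an entering window -/

/-- **The regular part of the profile is differentiable under interior regularity.** For a ground
state `u` of the window `a`: if `t ↦ D_t(ũ)` is differentiable at the interior prime-power lags
`log n < 2a`, then `η ↦ profile(η) − w_ent(a) · D_{2a}(ũ_η)` has derivative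
`V_sw(u) + Σ_{interior} Λ(n) n^{-1/2} · log n · d n` at `η = 0`. [folklore] -/
theorem hasDerivAt_weilDilationProfile_sub_entering {a : ℝ} {u : ℝ → ℂ}
    (hu : IsWeilGroundState a u) {d : ℕ → ℝ}
    (hd : ∀ n ∈ weilInteriorLagIndex a,
      HasDerivAt (weilIncrement (weilTrunc a u)) (d n) (Real.log n)) :
    HasDerivAt (fun η : ℝ ↦ weilDilationProfile a u η -
        weilEnteringWeight a * weilIncrement (weilDilate η (weilTrunc a u)) (2 * a))
      (weilSmallWindowVirial a u +
        ∑ n ∈ weilInteriorLagIndex a,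
          (ArithmeticFunction.vonMangoldt n : ℝ) / Real.sqrt n * (Real.log n * d n)) 0 := by
  set f := weilTrunc a u with hf_def
  have hvg : IsWeilGroundState a f := isWeilGroundState_weilTrunc hu
  have hf : MemLp f 2 := hvg.memLp
  have hfs : ∀ x, a ≤ |x| → f x = 0 := fun x hx ↦ weilTrunc_eq_zero u hx
  have hE := (stub_groundStateEnergy a _ hvg).1
  set P : ℕ → Prop := fun n : ℕ ↦ 2 ≤ n ∧ Real.log (n : ℝ) ≤ 2 * a with hP_def
  have hS : ∀ n ∈ (weilPrimeIndex (2 * a)).filter (fun n ↦ ¬P n), 2 ≤ n → 2 * a < Real.log n := by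
    intro n hn h2
    have h := (Finset.mem_filter.1 hn).2
    simp only [hP_def, not_and, not_le] at h
    exact h h2
  have hrest : HasDerivAt (fun η : ℝ ↦ ∑ n ∈ (weilPrimeIndex (2 * a)).filter (fun n ↦ ¬P n),
      (ArithmeticFunction.vonMangoldt n : ℝ) / Real.sqrt n *
        weilIncrement (weilDilate η f) (Real.log n)) 0 0 :=
    (hasDerivAt_const (0 : ℝ) _).congr_of_eventuallyEq
      (eventually_sum_weilIncrement_weilDilate_eq hf hfs _ hS)
  have hPo := (differentiableAt_weilPoleForm_weilDilate hf hfs).hasDerivAt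
  have hAr := hasDerivAt_archEnergy_weilDilate hf hE
  have hM := hasDerivAt_mass_weilDilate f
  have hInt := hasDerivAt_weilInteriorLagPart hd
  -- the profile, with the prime sum split as (prime-lag part) + (lags beyond the diameter)
  have e : weilDilationProfile a u = fun η ↦ weilPoleForm (weilDilate η f) +
      ((weilPrimeLagPart a u η + ∑ n ∈ (weilPrimeIndex (2 * a)).filter (fun n ↦ ¬P n),
          (ArithmeticFunction.vonMangoldt n : ℝ) / Real.sqrt n *
            weilIncrement (weilDilate η f) (Real.log n)) +
        ∫ t in Ioi (0 : ℝ), weilArchDensity t * weilIncrement (weilDilate η f) t) -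
      weilMarkovConstant (2 * a) * ∫ x, ‖weilDilate η f x‖ ^ 2 := by
    funext η
    simp only [weilDilationProfile, weilClosedForm, weilDirichletEnergy, weilPrimeLagPart, hP_def,
      ← hf_def, Finset.sum_filter_add_sum_filter_not]
  -- hence the regular part, with the entering term removed from the prime-lag part
  have e' : (fun η : ℝ ↦ weilDilationProfile a u η -
      weilEnteringWeight a * weilIncrement (weilDilate η (weilTrunc a u)) (2 * a)) =
      fun η ↦ weilPoleForm (weilDilate η f) +
        ((weilInteriorLagPart a u η + ∑ n ∈ (weilPrimeIndex (2 * a)).filter (fun n ↦ ¬P n),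
            (ArithmeticFunction.vonMangoldt n : ℝ) / Real.sqrt n *
              weilIncrement (weilDilate η f) (Real.log n)) +
          ∫ t in Ioi (0 : ℝ), weilArchDensity t * weilIncrement (weilDilate η f) t) -
        weilMarkovConstant (2 * a) * ∫ x, ‖weilDilate η f x‖ ^ 2 := by
    funext η
    have eη := congrFun e η
    beta_reduce at eη
    rw [eη, weilPrimeLagPart_eq_interior_add_entering, ← hf_def]
    ring
  rw [e']
  refine ((hPo.add ((hInt.add hrest).add hAr)).sub (hM.const_mul _)).congr_deriv ?_
  simp only [weilSmallWindowVirial, hf_def]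
  ring

/-- Consistency: where no lag enters (`log n ≠ 2a` for all `2 ≤ n`) the regular part is the whole
profile and the statement is `hasDerivAt_weilDilationProfile_of_hasDerivAt_weilIncrement` with the
interior lags. [folklore] -/
theorem hasDerivAt_weilDilationProfile_of_interior {a : ℝ} {u : ℝ → ℂ}
    (hu : IsWeilGroundState a u) (hna : ∀ n : ℕ, 2 ≤ n → Real.log (n : ℝ) ≠ 2 * a) {d : ℕ → ℝ}
    (hd : ∀ n ∈ weilInteriorLagIndex a,
      HasDerivAt (weilIncrement (weilTrunc a u)) (d n) (Real.log n)) :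
    HasDerivAt (weilDilationProfile a u)
      (weilSmallWindowVirial a u +
        ∑ n ∈ weilInteriorLagIndex a,
          (ArithmeticFunction.vonMangoldt n : ℝ) / Real.sqrt n * (Real.log n * d n)) 0 := by
  have h := hasDerivAt_weilDilationProfile_sub_entering hu hd
  simp only [weilEnteringWeight_eq_zero hna, zero_mul, sub_zero] at h
  exact h

end Summit.RiemannHypothesis.RiemannHypothesis.Theorems.PfPersistence

end
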